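import Mathlib.RingTheory.Flat.Localization
import Mathlib.RingTheory.Flat.FaithfullyFlat.Algebra
import Mathlib.RingTheory.Localization.AtPrime.Basic
import Mathlib.RingTheory.AdjoinRoot
import HarnessLib

/-!
# LOCAL RINGS OF A FLAT ALGEBRA AT A PRIME OVER A PRIME: FAITHFULLY FLAT, and UNRAMIFIED when the upper prime is generated by the lower one up to a unit multiple — the (β)/(γ)
# plumbing for BED Ω's chart-5 étale comparison (`k[W,y′] → k[W,y′,y₁]/(θ̃₅)`, `θ̃₅` monic of degree 9 in `y₁`), feeding ✓p703692 `FedderEtaleAscent`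
# (crux `FInjectiveMacaulayfication` stmt-ResolutionOfSingularities-15315, chain w45a; res-L1-w45a-plan-1 R23.18 ACK «(α)–(δ) are yours, in that order»; seat res-L1-w45a-stub-1 g15)

[OURS · L1 W4.5a] Support file (`--supports stmt-ResolutionOfSingularities-15315 --as helper`); theorems only; pure commutative algebra on top of Mathlib (`Module.FaithfullyFlat.of_flat_of_isLocalHom`,
the `LiesOver` localisation algebra `Localization.AtPrime.algebraOfLiesOver`, `Polynomial.Monic.free_adjoinRoot`). Nothing of the crux is proved. AI-written (AI review is weaker than
expert review).

* §1 ★ `faithfullyFlat_atPrime` — `B` flat over `A`, `P ⊂ B` over `p ⊂ A` ⇒ `A_p → B_P` faithfully flat (flat + local; the Mathlib pattern of `Algebra.HasGoingDown.of_flat`).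
* §2 ★ `map_maximalIdeal_eq` — if `P·B_P ⊆ (p·B)·B_P` then `𝔪_{A_p}·B_P = 𝔪_{B_P}` (UNRAMIFIED in the form ✓p703692 wants); `map_le_of_generator` — the standard-étale situation
  `P = p·B + (g)` with `u·g ∈ p·B` for some `u ∉ P` (for `B = A[T]/(θ)`, `g = T − a`, `u` = the cofactor of `θ(T) − θ(a)`, `u(a) = θ′(a)` a unit).
* §3 `flat_adjoinRoot_of_monic` — `A[T]/(θ)` is flat over `A` for monic `θ`.
[cite: Matsumura1987, Thm. 7.5 and §4 (flat local homomorphisms); StacksProject, Tag 00HS]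
-/

set_option linter.dupNamespace false

noncomputable section

namespace Summit.ResolutionOfSingularities.ResolutionOfSingularities.Theorems.FInjectiveMacaulayfication.StandardEtaleLocal

open IsLocalRing

variable {A B : Type} [CommRing A] [CommRing B] [Algebra A B]

/-! ## §1 ★ Faithful flatness of `A_p → B_P` -/

/-- ★ **`A_p → B_P` IS FAITHFULLY FLAT** for `B` flat over `A` and `P` lying over `p` (flat by localisation, faithful because the map is local). [folklore; Mathlib pattern of
`Algebra.HasGoingDown.of_flat`; cite: Matsumura1987, Thm. 7.5] -/
theorem faithfullyFlat_atPrime [Module.Flat A B] (p : Ideal A) [p.IsPrime] (P : Ideal B) [P.IsPrime] [P.LiesOver p] :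
    letI := Localization.AtPrime.algebraOfLiesOver p P
    Module.FaithfullyFlat (Localization.AtPrime p) (Localization.AtPrime P) := by
  letI := Localization.AtPrime.algebraOfLiesOver p P
  haveI : IsLocalHom (algebraMap (Localization.AtPrime p) (Localization.AtPrime P)) := by
    rw [RingHom.algebraMap_toAlgebra]
    exact Localization.isLocalHom_localRingHom p P (algebraMap A B) Ideal.LiesOver.over
  exact Module.FaithfullyFlat.of_flat_of_isLocalHom

/-! ## §2 ★ Unramifiedness -/

/-- ★ **`𝔪_{A_p}·B_P = 𝔪_{B_P}`** as soon as `P·B_P ⊆ (p·B)·B_P` (the other inclusion is automatic). [folklore] -/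
theorem map_maximalIdeal_eq (p : Ideal A) [p.IsPrime] (P : Ideal B) [P.IsPrime] [P.LiesOver p]
    (hgen : P.map (algebraMap B (Localization.AtPrime P)) ≤ (p.map (algebraMap A B)).map (algebraMap B (Localization.AtPrime P))) :
    letI := Localization.AtPrime.algebraOfLiesOver p P
    (maximalIdeal (Localization.AtPrime p)).map (algebraMap (Localization.AtPrime p) (Localization.AtPrime P)) = maximalIdeal (Localization.AtPrime P) := by
  letI := Localization.AtPrime.algebraOfLiesOver p P
  rw [← Localization.AtPrime.map_eq_maximalIdeal (I := p), ← Localization.AtPrime.map_eq_maximalIdeal (I := P), Ideal.map_map,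
    ← IsScalarTower.algebraMap_eq A (Localization.AtPrime p) (Localization.AtPrime P), IsScalarTower.algebraMap_eq A B (Localization.AtPrime P), ← Ideal.map_map]
  refine le_antisymm (Ideal.map_mono (Ideal.map_le_iff_le_comap.2 (le_of_eq (Ideal.LiesOver.over (P := P) (p := p))))) hgen

/-- **The standard-étale situation**: `P = p·B + (g)` and `u·g ∈ p·B` for some `u ∉ P` ⇒ `P·B_P ⊆ (p·B)·B_P`. (For `B = A[T]/(θ)` at a rational point `T = a` with `θ(a) ∈ p`: `g = T − a`,
`u` = the cofactor in `θ(T) − θ(a) = (T − a)·u`, `u ∉ P` iff `θ′(a) ∉ p`.) [folklore] -/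
theorem map_le_of_generator (p : Ideal A) (P : Ideal B) [P.IsPrime] (g u : B) (hP : P = p.map (algebraMap A B) ⊔ Ideal.span {g}) (hu : u ∉ P)
    (hug : u * g ∈ p.map (algebraMap A B)) :
    P.map (algebraMap B (Localization.AtPrime P)) ≤ (p.map (algebraMap A B)).map (algebraMap B (Localization.AtPrime P)) := by
  have hunit : IsUnit (algebraMap B (Localization.AtPrime P) u) := IsLocalization.map_units (Localization.AtPrime P) (⟨u, hu⟩ : P.primeCompl)
  have hg : algebraMap B (Localization.AtPrime P) g ∈ (p.map (algebraMap A B)).map (algebraMap B (Localization.AtPrime P)) := by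
    obtain ⟨v, hv⟩ := hunit.exists_left_inv
    have : algebraMap B (Localization.AtPrime P) g = v * algebraMap B (Localization.AtPrime P) (u * g) := by rw [map_mul, ← mul_assoc, hv, one_mul]
    rw [this]
    exact Ideal.mul_mem_left _ _ (Ideal.mem_map_of_mem _ hug)
  refine Ideal.map_le_iff_le_comap.2 (hP.le.trans (sup_le Ideal.le_comap_map ?_))
  rw [Ideal.span_le, Set.singleton_subset_iff]
  exact Ideal.mem_comap.2 hg

/-- ★ **UNRAMIFIED, standard-étale form**: `P = p·B + (g)`, `u·g ∈ p·B`, `u ∉ P` ⇒ `𝔪_{A_p}·B_P = 𝔪_{B_P}`. [folklore] -/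
theorem map_maximalIdeal_eq_of_generator (p : Ideal A) [p.IsPrime] (P : Ideal B) [P.IsPrime] [P.LiesOver p] (g u : B)
    (hP : P = p.map (algebraMap A B) ⊔ Ideal.span {g}) (hu : u ∉ P) (hug : u * g ∈ p.map (algebraMap A B)) :
    letI := Localization.AtPrime.algebraOfLiesOver p P
    (maximalIdeal (Localization.AtPrime p)).map (algebraMap (Localization.AtPrime p) (Localization.AtPrime P)) = maximalIdeal (Localization.AtPrime P) :=
  map_maximalIdeal_eq p P (map_le_of_generator p P g u hP hu hug)

/-! ## §3 Flatness of `A[T]/(θ)` for monic `θ` -/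

/-- **`A[T]/(θ)` IS FLAT OVER `A` FOR MONIC `θ`** (free with basis `1, T, …, T^{deg θ − 1}`). [folklore; Mathlib `Polynomial.Monic.free_adjoinRoot`] -/
theorem flat_adjoinRoot_of_monic {θ : Polynomial A} (hθ : θ.Monic) : Module.Flat A (AdjoinRoot θ) := by
  haveI := hθ.free_adjoinRoot
  infer_instance

end Summit.ResolutionOfSingularities.ResolutionOfSingularities.Theorems.FInjectiveMacaulayfication.StandardEtaleLocal

end
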